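import Mathlib
import Summits.Ventures.HodgeRepro2.Defs
import Summits.Ventures.HodgeRepro2.Existence
import Summits.Ventures.HodgeRepro2.Faces
import Summits.Ventures.HodgeRepro2.Liu
import Summits.Ventures.HodgeRepro2.LiuOscillator

/-!
# The face datum: the four oscillator triples of a rank-four face

Blind cell `pub-hodge-repro2`, seat p2 (file 13).  This file instantiates the automorphic datum of
`Liu.lean` / `LiuOscillator.lean` (Liu, Cambridge J. Math. 9 (2021), Definitions 4.11–4.12,
Proposition 4.13) on a rank-four face `T : Fin 4 → Set (K →+* ℂ)` in the sense of `Defs.lean`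
(`IsWeilFace`: four CM types, every embedding in exactly two of them — Deligne, LNM 900, Ch. I,
Prop. 4.4), for a Galois CM field `K` (the brief's «Galois CM field F»).  The inverse CM type
`inverseType τ₀ Φ = Φ^{-1}` (Galois coordinates of a base embedding `τ₀`; Shimura 1998 §8.4
Example (1): for `F` abelian over `ℚ` and `(F; {φ_i})` primitive the reflex of `(F; {φ_i})` is
`(F; {φ_i^{-1}})`) and the lemma «the inverse of a balanced tetrahedron is balanced»
(`isWeilFace_inverseType`) are p1's, landed in `Faces.lean`; they are REUSED here, not restated.

* `FaceOscillatorData`: four adèlic oscillator triples `(μ_i, ε_{e_i}, χ_i)` with `μ_i` of weight one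
  and CM type `T_i^{-1}` (the reflex relabelling of `route/TIER3.md` §5(i): `A_μ` of Liu Def 4.5 has
  the CM type `T_i` exactly when `Φ_μ = T_i^{-1}`) and `ε_{e_i}` `μ_i`-admissible (Def 4.12) — the
  automorphic datum K5 of `route/TIER3.md` §2 (Liu row), §3.5 and §4.4 rows L6–L8.
* PROVED: each vertex triple is admissible in the sense of Proposition 4.13; under the statement
  shape `LiuProp413Shape` each vertex piece `ω(μ_i, ε_i, χ_i)` occurs in `H¹_{B,τ′}(A_∞, ℂ)` with
  multiplicity exactly one (row C1); for every CM type an admissible sign element `e` exists (row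
  L7); the face datum exists modulo the printed existence of the characters (row L6).
* PROVED (change of the base embedding): when `Gal(K/ℚ)` is abelian, replacing `τ₀` by `τ₀ ∘ α`
  replaces `Φ^{-1}` by its translate by `α²` — the inverse type is intrinsically a CM type of the
  SUBFIELD `τ₀(K) = M_μ ⊂ ℂ` (Liu Def 4.3(2), Def 4.5(2) «with respect to the inclusion
  `M_μ → ℂ`»), and its transport to the abstract field `K` needs the identification `K ≅ τ₀(K)`;
  the natural choice for the transfer is Liu's fixed `τ′` (p. 47 l. 26) = the brief's `τ₁`.
-/

namespace Summit.Ventures.HodgeRepro2.ShimuraData.Liu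

open NumberField

variable (K : Type*) [Field K] [NumberField K] [IsCMField K]

/-! ## 1. Admissible sign elements exist for every CM type (row L7) -/

/-- Row L7 of `route/TIER3.md` §4.4: for every CM type `Φ` there is `e ∈ E^{×−}` with
`Im τ′(e) < 0` for all `τ′ ∈ Φ`, i.e. `ε_e` is `μ`-admissible for every `μ` of CM type `Φ`
(Definition 4.12, sign condition for the representative `e`) — from `Existence.lean` (weak
approximation, `exists_imaginary_cmType_eq`), with `e := −δ`.  PROVED. -/
theorem exists_isMuAdmissibleRep {Φ : Set (K →+* ℂ)} (hΦ : IsCMType K Φ) :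
    ∃ e : K, IsMuAdmissibleRep K Φ e := by
  obtain ⟨δ, hδ, hδne, hΦδ⟩ := exists_imaginary_cmType_eq K Φ hΦ
  refine ⟨-δ, ⟨?_, neg_ne_zero.mpr hδne⟩, ?_⟩
  · have : IsCMField.complexConj K δ = -δ := hδ
    rw [map_neg, this, neg_neg]
  · intro τ' hτ'
    rw [← hΦδ] at hτ'
    have h : 0 < (-Complex.I * τ' δ).re := hτ'
    rw [map_neg, Complex.neg_im]
    have h' : (-Complex.I * τ' δ).re = (τ' δ).im := by simp
    linarith

/-! ## 2. Change of the base embedding for the inverse type (`Faces.lean`) -/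

section Galois

variable [IsGalois ℚ K] (τ₀ : K →+* ℂ)

omit [IsCMField K] in
/-- Galois coordinates with respect to the base embedding `τ₀ ∘ α`: `(τ₀ ∘ α) ∘ σ = τ₀ ∘ (α σ)`. -/
theorem galEmb_galEmb (α σ : Gal(K/ℚ)) :
    galEmb K (galEmb K τ₀ α) σ = galEmb K τ₀ (α * σ) := by
  rw [galEmb_apply, galEmb_apply, galEmb_apply]
  ext x
  simp [AlgEquiv.mul_apply]

omit [IsCMField K] in
/-- The Galois coordinate of `ψ` with respect to `τ₀ ∘ α` is `α^{-1}` times its coordinate with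
respect to `τ₀`. -/
theorem galEmb_symm_galEmb (α : Gal(K/ℚ)) (ψ : K →+* ℂ) :
    (galEmb K (galEmb K τ₀ α)).symm ψ = α⁻¹ * (galEmb K τ₀).symm ψ := by
  apply (galEmb K (galEmb K τ₀ α)).injective
  rw [Equiv.apply_symm_apply, galEmb_galEmb, mul_inv_cancel_left, Equiv.apply_symm_apply]

omit [IsCMField K] in
/-- CHANGE OF THE BASE EMBEDDING (the honest form of «`Φ^{-1}`» for an abstract field): when
`Gal(K/ℚ)` is abelian (the brief's sextic Galois CM field, `route/TIER3.md` §5(i)), replacing the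
base embedding `τ₀` by `τ₀ ∘ α` replaces `Φ^{-1}` by its translate by `α²`:
`τ₀ ∘ σ ∈ Φ^{-1}_{τ₀ ∘ α} ↔ τ₀ ∘ σ^{-1} ∘ α² ∈ Φ`.  PROVED. -/
theorem galEmb_mem_inverseType_galEmb_iff (hcomm : ∀ a b : Gal(K/ℚ), a * b = b * a)
    (α : Gal(K/ℚ)) (Φ : Set (K →+* ℂ)) (σ : Gal(K/ℚ)) :
    galEmb K τ₀ σ ∈ inverseType K (galEmb K τ₀ α) Φ ↔ galEmb K τ₀ (σ⁻¹ * α * α) ∈ Φ := by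
  have h1 : galEmb K τ₀ σ = galEmb K (galEmb K τ₀ α) (α⁻¹ * σ) := by
    rw [galEmb_galEmb, mul_inv_cancel_left]
  rw [h1, mem_inverseType_iff, galEmb_galEmb, mul_inv_rev, inv_inv, ← mul_assoc, hcomm α σ⁻¹]

end Galois

/-! ## 3. The four oscillator triples of a face -/

/-- The automorphic datum of the transfer for the rank-four face `T` (`route/TIER3.md` §2 Liu row,
§3.5, §4.4 rows L6–L8; K5): four adèlic oscillator triples `(μ_i, ε_{e_i}, χ_i)` (Liu Def 4.11),
the `i`-th with `μ_i` conjugate symplectic of weight one and CM type `Φ_{μ_i} = T_i^{-1}` (the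
reflex relabelling, §5(i); `inverseType` of `Faces.lean` in the Galois coordinates of `τ₀`),
`e_i ∈ E^{×−}` with `Im τ′(e_i) < 0` for `τ′ ∈ T_i^{-1}` (Def 4.12), `χ_i` a character of
`E¹\(𝔸_E^∞)^1` (`χ_i = 1` in the transfer, row L8). -/
structure FaceOscillatorData [IsGalois ℚ K] (c : IdeleConjugation K) (χEF : QuadraticCharacter K c)
    (τ₀ : K →+* ℂ) (T : Fin 4 → Set (K →+* ℂ)) where
  /-- `T` is a rank-four face -/
  face : IsWeilFace K T
  /-- the four triples -/
  vertex : Fin 4 → OscillatorTriple K c χEF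
  /-- `μ_i` has weight one and CM type `T_i^{-1}` -/
  weightOne : ∀ i, IsWeightOne K (inverseType K τ₀ (T i)) (vertex i).μ
  /-- `ε_{e_i}` is `μ_i`-admissible -/
  admissible : ∀ i, IsMuAdmissibleRep K (inverseType K τ₀ (T i)) (vertex i).e

namespace FaceOscillatorData

variable {K} [IsGalois ℚ K] {c : IdeleConjugation K} {χEF : QuadraticCharacter K c}
  {τ₀ : K →+* ℂ} {T : Fin 4 → Set (K →+* ℂ)}

/-- The CM types `T_i^{-1}` of the four characters form a rank-four face again (p1's
`isWeilFace_inverseType`: «inversion preserves balance», `route/TIER3.md` §5(i)). -/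
theorem isWeilFace_inv (D : FaceOscillatorData K c χEF τ₀ T) :
    IsWeilFace K (fun i => inverseType K τ₀ (T i)) :=
  isWeilFace_inverseType K τ₀ D.face

/-- Every vertex triple is «an adèlic oscillator triple in which `μ` is of weight one and `ε` is
`μ`-admissible» — a summand of Proposition 4.13. -/
theorem isAdmissible (D : FaceOscillatorData K c χEF τ₀ T) (i : Fin 4) :
    (D.vertex i).IsAdmissible :=
  ⟨inverseType K τ₀ (T i), isCMType_inverseType K τ₀ (D.face.1 i), D.weightOne i, D.admissible i⟩

/-- THE INSTANTIATED CONCLUSION (row C1 of `route/TIER3.md` §4.4): under the statement shape of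
Proposition 4.13 and its hypothesis `n ⩾ 3` (row L2: `n = 3`), for every embedding `τ′ : E → ℂ` each vertex piece `ω(μ_i, ε_i, χ_i)` occurs in
`H¹_{B,τ′}(A_∞, ℂ)` with multiplicity exactly one — «the dimension of `H¹_{B,τ′}(A_∞, ℂ)[ω(μ, ε, χ)]`
is 1» (p. 49 ll. 33–34). -/
theorem mult_eq_one (S : AlbaneseH1Shape K c χEF) (hn : 3 ≤ S.rank) (hS : LiuProp413Shape K S)
    (D : FaceOscillatorData K c χEF τ₀ T) (τ' : K →+* ℂ) (i : Fin 4) :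
    S.mult τ' (S.osc (D.vertex i)) = 1 :=
  (hS hn).1 τ' _ (D.isAdmissible i)

/-- The conjugate vertex triples `(μ_i^c, −ε_i, χ_i)` occur with multiplicity one as well (the
`μ^c`-partners of row L11 / §5(k)). -/
theorem mult_conj_eq_one (S : AlbaneseH1Shape K c χEF) (hn : 3 ≤ S.rank)
    (hS : LiuProp413Shape K S) (D : FaceOscillatorData K c χEF τ₀ T) (τ' : K →+* ℂ) (i : Fin 4) :
    S.mult τ' (S.osc (D.vertex i).conj) = 1 :=
  (hS hn).1 τ' _ (OscillatorTriple.isAdmissible_conj K (D.isAdmissible i))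

/-- Each vertex's sign element determines its CM type: `{τ′ | Im τ′(e_i) < 0} = T_i^{-1}`. -/
theorem cmTypeOfImaginary_eq (D : FaceOscillatorData K c χEF τ₀ T) (i : Fin 4) :
    cmTypeOfImaginary K (D.vertex i).e = inverseType K τ₀ (T i) :=
  ((isMuAdmissibleRep_iff_cmTypeOfImaginary_eq K (isCMType_inverseType K τ₀ (D.face.1 i))
    (D.vertex i).e).mp (D.admissible i)).2

/-- THE FACE LEVEL (`route/TIER3.md` §6 item 1(a), «existential = routine … + p2's `K := ∩K_i`»):
if each vertex piece has non-zero invariants at some small level `K_i` (`OscillatorAdmissibleShape`),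
then at the common level `K = K_0 ∩ K_1 ∩ K_2 ∩ K_3` (sufficiently small) ALL FOUR vertex pieces have
non-zero invariants simultaneously.  PROVED. -/
theorem exists_common_level (S : AlbaneseH1Shape K c χEF) (hadm : OscillatorAdmissibleShape K S)
    (D : FaceOscillatorData K c χEF τ₀ T) :
    ∃ L : S.Level, S.IsSmall L ∧ ∀ i, 0 < S.dimInv (S.osc (D.vertex i)) L := by
  choose L hL using fun i => hadm _ (D.isAdmissible i)
  refine ⟨Finset.univ.inf' Finset.univ_nonempty L, ?_, ?_⟩
  · exact S.isSmall_of_le (Finset.inf'_le _ (Finset.mem_univ 0)) (hL 0).1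
  · intro i
    exact lt_of_lt_of_le (hL i).2 (S.dimInv_anti _ (Finset.inf'_le _ (Finset.mem_univ i)))

/-- At the face level every vertex character has `d(μ_i, K) ≥ 1` (the multiplicity of `A_{μ_i}` in
the Albanese decomposition of Corollary 4.20), provided the vertex triple is among those summed in
`d(μ_i, K)`.  PROVED. -/
theorem exists_common_level_liuMultiplicity (S : AlbaneseH1Shape K c χEF)
    (hadm : OscillatorAdmissibleShape K S) (D : FaceOscillatorData K c χEF τ₀ T)
    (Tset : Fin 4 → Finset (OscillatorTriple K c χEF)) (hmem : ∀ i, D.vertex i ∈ Tset i) :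
    ∃ L : S.Level, S.IsSmall L ∧ ∀ i, 1 ≤ liuMultiplicity K S (Tset i) L := by
  obtain ⟨L, hL, hpos⟩ := D.exists_common_level S hadm
  exact ⟨L, hL, fun i => (hpos i).trans_le (dimInv_le_liuMultiplicity K S (hmem i) L)⟩

/-- Each vertex character is a weight-one conjugate symplectic character (the standing hypothesis
of Theorem 4.18 / Corollary 4.20). -/
theorem isWeightOneConjugateSymplectic (D : FaceOscillatorData K c χEF τ₀ T) (i : Fin 4) :
    IsWeightOneConjugateSymplectic K c χEF (D.vertex i).μ :=
  OscillatorTriple.isWeightOneConjugateSymplectic K (D.isAdmissible i)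

end FaceOscillatorData

/-- The existence statement for the characters of a face datum (row L6 of `route/TIER3.md` §4.4;
Dimitrov–Ramakrishnan, Doc. Math. 20 (2015), Lemma 3.5 — NOT proved here): for every CM type `Φ`
there is a conjugate symplectic automorphic character of weight one with CM type `Φ`. -/
def WeightOneCharacterExists (c : IdeleConjugation K) (χEF : QuadraticCharacter K c) : Prop :=
  ∀ Φ : Set (K →+* ℂ), IsCMType K Φ →
    ∃ μ : AutomorphicCharacter K, IsConjugateSymplectic K c χEF μ ∧ IsWeightOne K Φ μ

/-- Given the existence statement for characters (row L6) and any character `χ` of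
`E¹\(𝔸_E^∞)^1` (row L8), every rank-four face carries a face datum: the sign elements are supplied
by `exists_isMuAdmissibleRep` (row L7).  PROVED modulo the named existence statement. -/
theorem exists_faceOscillatorData [IsGalois ℚ K] (c : IdeleConjugation K)
    (χEF : QuadraticCharacter K c) (hex : WeightOneCharacterExists K c χEF) (χ : OneCharacter K c)
    (τ₀ : K →+* ℂ) {T : Fin 4 → Set (K →+* ℂ)} (hT : IsWeilFace K T) :
    Nonempty (FaceOscillatorData K c χEF τ₀ T) := by
  have hface := isWeilFace_inverseType K τ₀ hT
  choose μ hμ using fun i => hex _ (hface.1 i)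
  choose e he using fun i => exists_isMuAdmissibleRep K (hface.1 i)
  exact ⟨{ face := hT
           vertex := fun i => { μ := μ i, μ_symplectic := (hμ i).1, e := e i, e_mem := (he i).1,
                                χ := χ }
           weightOne := fun i => (hμ i).2
           admissible := fun i => he i }⟩

end Summit.Ventures.HodgeRepro2.ShimuraData.Liu
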